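import Mathlib.MeasureTheory.Group.FundamentalDomain
import Mathlib.Analysis.Complex.UpperHalfPlane.Measure
import Mathlib.Analysis.SpecialFunctions.Log.Base
import HarnessLib

/-!
# The conjugated annulus `M • {1 ≤ |τ| < κ₀}` is a fundamental domain for a group acting by conjugated homotheties

[[cite: Shintani1975, §2, proof of Prop. 2.3 (p. 104)]] — for an anisotropic indefinite vector the
stabiliser `Γ_x` is infinite cyclic, generated by a hyperbolic element; after moving the two roots
to `0` and `∞` (`M ∈ SL₂(ℝ)`) it acts by homotheties `w ↦ κ₀^m w`, and a fundamental domain in `ℍ`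
is the annulus `1 ≤ |w| < κ₀` (Shintani integrates over `Γ_x∖G`; in the `ℍ`-formulation of
`ShintaniOrbitIntegrals` this is the annulus `1 ≤ |w| < ε²`).  We PROVE, for Mathlib's
`MeasureTheory.IsFundamentalDomain` and any group `Γ'` acting on `ℍ` with
`M⁻¹(γ w) = κ₀^{m(γ)} · M⁻¹ w` (`m : Γ' → ℤ` bijective, `κ₀ > 1`):

* `exists_zpow_mul_mem_Ico`, `zpow_eq_of_mul_mem_Ico` — normalising a positive real into
  `[1, κ₀)` by a unique integer power of `κ₀`;
* `continuous_coe_sl_smul` — continuity of `w ↦ g • w` for `g ∈ SL₂(ℝ)` (explicit Möbius formula);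
* **`isFundamentalDomain_conj_hannulus`** — `M • hannulus κ₀` is a fundamental domain for `Γ'`
  (every orbit meets it exactly once).

No named facts; the only definition is `hannulus`.
-/

noncomputable section

open scoped MatrixGroups Topology Pointwise
open UpperHalfPlane hiding I
open Complex Filter MeasureTheory Set

namespace Literature.NumberTheory.EllipticCurves.ModularForms

/-- The coordinate of `g • w` for `g ∈ SL₂(ℝ)` is continuous in `w`. [folklore] -/
theorem continuous_coe_sl_smul (g : SL(2, ℝ)) : Continuous fun w : ℍ ↦ (((g • w : ℍ)) : ℂ) := by
  have h : (fun w : ℍ ↦ (((g • w : ℍ)) : ℂ)) = fun w : ℍ ↦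
      (((g 0 0 : ℝ) : ℂ) * (w : ℂ) + ((g 0 1 : ℝ) : ℂ)) / (((g 1 0 : ℝ) : ℂ) * (w : ℂ) + ((g 1 1 : ℝ) : ℂ)) := by
    funext w
    rw [UpperHalfPlane.coe_specialLinearGroup_apply]
    rfl
  rw [h]
  refine Continuous.div (by fun_prop) (by fun_prop) (fun w ↦ ?_)
  have := UpperHalfPlane.denom_ne_zero (g : GL (Fin 2) ℝ) w
  simpa [UpperHalfPlane.denom] using this

/-- The annulus `{τ ∈ ℍ : 1 ≤ |τ| < κ₀}`. [folklore] -/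
def hannulus (κ₀ : ℝ) : Set ℍ := {τ : ℍ | ‖(τ : ℂ)‖ ∈ Ico 1 κ₀}

/-- The annulus is measurable. [folklore] -/
theorem measurableSet_hannulus (κ₀ : ℝ) : MeasurableSet (hannulus κ₀) :=
  (continuous_norm.comp UpperHalfPlane.continuous_coe).measurable measurableSet_Ico

/-- Normalising a positive real into `[1, κ₀)` by an integer power of `κ₀ > 1`. [folklore] -/
theorem exists_zpow_mul_mem_Ico {κ₀ : ℝ} (hκ : 1 < κ₀) {r : ℝ} (hr : 0 < r) :
    ∃ j : ℤ, κ₀ ^ j * r ∈ Ico 1 κ₀ := by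
  have hκ0 : 0 < κ₀ := by linarith
  have hlog : 0 < Real.log κ₀ := Real.log_pos hκ
  set t : ℝ := Real.log r / Real.log κ₀ with ht
  refine ⟨-⌊t⌋, ?_⟩
  have hr' : r = κ₀ ^ t := by
    rw [Real.rpow_def_of_pos hκ0, ht, mul_div_cancel₀ _ hlog.ne', Real.exp_log hr]
  have key : κ₀ ^ (-⌊t⌋ : ℤ) * r = κ₀ ^ (t - ⌊t⌋ : ℝ) := by
    rw [hr', ← Real.rpow_intCast, ← Real.rpow_add hκ0]
    congr 1; push_cast; ring
  rw [key]
  constructor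
  · exact Real.one_le_rpow hκ.le (by linarith [Int.floor_le t])
  · calc κ₀ ^ (t - ⌊t⌋ : ℝ) < κ₀ ^ (1 : ℝ) :=
          Real.rpow_lt_rpow_of_exponent_lt hκ (by linarith [Int.lt_floor_add_one t])
      _ = κ₀ := Real.rpow_one κ₀

/-- Two integer powers of `κ₀ > 1` scaling numbers of `[1, κ₀)` to the same value are equal.
[folklore] -/
theorem zpow_eq_of_mul_mem_Ico {κ₀ : ℝ} (hκ : 1 < κ₀) {a b : ℤ} {r s : ℝ} (hr : r ∈ Ico (1 : ℝ) κ₀)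
    (hs : s ∈ Ico (1 : ℝ) κ₀) (h : κ₀ ^ a * r = κ₀ ^ b * s) : a = b := by
  have hκ0 : 0 < κ₀ := by linarith
  by_contra hab
  rcases lt_or_gt_of_ne hab with hlt | hlt
  · -- `κ₀^{b-a} s = r`: but `κ₀^{b-a} s ≥ κ₀ > r`
    have h1 : κ₀ ^ (b - a) * s = r := by
      have : κ₀ ^ b * s = κ₀ ^ a * (κ₀ ^ (b - a) * s) := by
        rw [← mul_assoc, ← zpow_add₀ hκ0.ne']; congr 2; ring
      rw [this] at h
      exact (mul_left_cancel₀ (zpow_ne_zero a hκ0.ne') h).symm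
    have h2 : κ₀ ≤ κ₀ ^ (b - a) := by
      calc κ₀ = κ₀ ^ (1 : ℤ) := (zpow_one κ₀).symm
        _ ≤ κ₀ ^ (b - a) := zpow_le_zpow_right₀ hκ.le (by omega)
    nlinarith [hr.2, hs.1, h1]
  · have h1 : κ₀ ^ (a - b) * r = s := by
      have : κ₀ ^ a * r = κ₀ ^ b * (κ₀ ^ (a - b) * r) := by
        rw [← mul_assoc, ← zpow_add₀ hκ0.ne']; congr 2; ring
      rw [this] at h
      exact mul_left_cancel₀ (zpow_ne_zero b hκ0.ne') h
    have h2 : κ₀ ≤ κ₀ ^ (a - b) := by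
      calc κ₀ = κ₀ ^ (1 : ℤ) := (zpow_one κ₀).symm
        _ ≤ κ₀ ^ (a - b) := zpow_le_zpow_right₀ hκ.le (by omega)
    nlinarith [hs.2, hr.1, h1]

/-- **The conjugated annulus is a fundamental domain.**  Let a group `Γ'` act on `ℍ` through
homotheties conjugated by `M ∈ SL₂(ℝ)`: `M⁻¹(γ w) = κ₀^{m(γ)} · M⁻¹ w` with `m : Γ' → ℤ` bijective
and `κ₀ > 1`.  Then `M • {1 ≤ |τ| < κ₀}` is a fundamental domain for `Γ'` (exact tiling).
[folklore] -/
theorem isFundamentalDomain_conj_hannulus {Γ' : Type*} [Group Γ'] [MulAction Γ' ℍ] (M : SL(2, ℝ))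
    {κ₀ : ℝ} (hκ : 1 < κ₀) (m : Γ' → ℤ) (hm : Function.Bijective m)
    (hact : ∀ (γ : Γ') (w : ℍ), (((M⁻¹ • (γ • w) : ℍ)) : ℂ) = ((κ₀ ^ (m γ) : ℝ) : ℂ) * (((M⁻¹ • w : ℍ)) : ℂ)) :
    IsFundamentalDomain Γ' (M • hannulus κ₀) (volume : Measure ℍ) where
  nullMeasurableSet := by
    have : M • hannulus κ₀ = (fun w : ℍ ↦ M⁻¹ • w) ⁻¹' hannulus κ₀ := by
      ext w
      rw [Set.mem_smul_set_iff_inv_smul_mem, Set.mem_preimage]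
    rw [this]
    refine (MeasurableSet.nullMeasurableSet ?_)
    exact ((continuous_norm.comp (continuous_coe_sl_smul M⁻¹)).measurable measurableSet_Ico)
  ae_covers := by
    refine Eventually.of_forall fun w ↦ ?_
    have hr : 0 < ‖(((M⁻¹ • w : ℍ)) : ℂ)‖ := norm_pos_iff.mpr (UpperHalfPlane.ne_zero _)
    obtain ⟨j, hj⟩ := exists_zpow_mul_mem_Ico hκ hr
    obtain ⟨γ, hγ⟩ := hm.2 j
    refine ⟨γ, ?_⟩
    rw [Set.mem_smul_set_iff_inv_smul_mem]
    show ‖(((M⁻¹ • (γ • w) : ℍ)) : ℂ)‖ ∈ Ico 1 κ₀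
    rw [hact γ w, hγ, norm_mul, Complex.norm_real, Real.norm_of_nonneg (zpow_nonneg (by linarith) _)]
    exact hj
  aedisjoint := by
    intro γ γ' hne
    refine Disjoint.aedisjoint ?_
    change Disjoint (γ • (M • hannulus κ₀)) (γ' • (M • hannulus κ₀))
    rw [Set.disjoint_left]
    rintro w ⟨u, hu, rfl⟩ ⟨u', hu', heq⟩
    rw [Set.mem_smul_set_iff_inv_smul_mem] at hu hu'
    have h1 := hact γ u
    have h2 := hact γ' u'
    have heq' : (((M⁻¹ • (γ' • u') : ℍ)) : ℂ) = (((M⁻¹ • (γ • u) : ℍ)) : ℂ) := by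
      have : γ' • u' = γ • u := heq
      rw [this]
    rw [h1, h2] at heq'
    have hnorm := congrArg (fun z : ℂ ↦ ‖z‖) heq'
    simp only [norm_mul, Complex.norm_real] at hnorm
    rw [Real.norm_of_nonneg (zpow_nonneg (by linarith) _), Real.norm_of_nonneg (zpow_nonneg (by linarith) _)] at hnorm
    have hmm : m γ' = m γ := zpow_eq_of_mul_mem_Ico hκ hu' hu hnorm
    exact hne (hm.1 hmm.symm)

end Literature.NumberTheory.EllipticCurves.ModularForms
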